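import Summits.Ventures.KdS.RouteWNonRes
import Summits.Ventures.KdS.RouteWTransferHolds
import Summits.Ventures.KdS.RouteWGaugeGlue
import Summits.Ventures.KdS.RouteWSwappedEnergy
import Literature.Analysis.ODE.HeunEulerRL

/-!
# Venture KdS — ROUTE W: `EulerRLNonRes` DISCHARGED; H3 for spins `s < 1` with no open hypothesis

HONEST FRAMING (venture `Summits/Ventures/KdS`, cell `pub-kds`; MONDAY-REBALANCE item 2): this
file PROVES `eulerRLNonRes_holds : RouteW.EulerRLNonRes` — the one-sided Euler / Riemann–Liouville
transform for Heun's equation off resonance (`Literature.Analysis.ODE.GeneralHeun.eulerRL_nonres`,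
K. Takemura's Prop. 1.2 on the real segment with Riemann–Liouville regularisation and
injectivity) — and records the consequences for route W:

* `radial_vanishing_lt_one` — for subextremal Kerr–de Sitter parameters, `0 ≤ a`, every spin
  `s < 1` (the cell's `s = −2, 0`), `Im ω > 0`, `Im(λ̄ω̄) ≤ 0`, `|ω| ∉ |m|(0, Ω_SR)` and CTdC's pair
  condition on `m₁ + m₃ = −2(η₁+η₀)`, every generic-boundary radial Teukolsky mode vanishes —
  PROVED with NO cited fact and NO open hypothesis (inputs: `transfer_holds`, `eulerRLNonRes_holds`,
  `gaugeGlue_holds`, `swappedEnergyVanishing_holds`, all theorems of this venture / Literature);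
* `prop38_of_spinFlip : SpinFlip → CasalsTeixeiraDaCosta2022_partialModeStabilityProp38` — the
  cell's cited fact H3 in full now rests on the spin-flip statement for `s ≥ 1` alone.

What this is NOT: a statement about `s ≥ 1` (needs `SpinFlip`), nor about the resonant set
(excluded by CTdC's own pair condition, see `RouteWNonRes.lean`), nor mode stability of
Kerr–de Sitter by itself (H1′ remains cited in the displayed theorems of the cell).

References: Casals–Teixeira da Costa, Commun. Math. Phys. 394 (2022) 797–832
[CasalsTeixeiradacosta2022] Prop. 3.8, Thm 3.10; K. Takemura, J. Math. Soc. Japan 69 (2017)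
849–891 [Takemura2017] Prop. 1.2.
-/

noncomputable section

open Set Complex

namespace Summit.Ventures.KdS

namespace RouteW

open Literature.Analysis.ODE Literature.Analysis.ODE.GeneralHeun
open Literature.Geometry.Lorentzian Literature.Geometry.Lorentzian.KerrDeSitter

/-- **K_B DISCHARGED: `EulerRLNonRes` holds** (Takemura's Prop. 1.2 on the real segment, with
Riemann–Liouville regularisation and injectivity off resonance; `eulerRL_nonres`). -/
theorem eulerRLNonRes_holds : EulerRLNonRes := by
  intro z₂ α β γ δ ε q η ρ v hz₂ hF hroot hρ hre hnr hv
  obtain ⟨hsol, h1, h2⟩ := hv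
  exact eulerRL_nonres z₂ α β γ δ ε q η ρ v hz₂ hF hroot hρ hre hnr hsol h1 h2

/-- **Route W closed for spins `s < 1`** (the cell's `s = −2` and `s = 0`): every generic-boundary
radial Teukolsky mode with `Im ω > 0`, `Im(λ̄ω̄) ≤ 0`, `|ω| ∉ |m|(0,Ω_SR)` and CTdC's pair condition
on `m₁ + m₃ = −2(η₁+η₀)` vanishes on `(r₊, r_c)`. PROVED — no cited fact, no open hypothesis. -/
theorem radial_vanishing_lt_one {M a Λ s : ℝ} {ω : ℂ} {m : ℝ} {lam : ℂ} {R : ℝ → ℂ}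
    (hsub : IsSubextremal M a Λ) (ha : 0 ≤ a) (hs : s < 1) (hω : 0 < ω.im)
    (hlam : (lambdaBar a Λ s ω m lam * (starRingEnd ℂ) ω).im ≤ 0)
    (hSR : ¬(0 < ‖ω‖ ∧ ‖ω‖ < |m| * superradiantUpper M a Λ))
    (hp₃ : PairCondition (-2 * (etaEvent M a Λ ω m + etaCauchy M a Λ ω m)))
    (hR : IsRadialTeukolskySolution M a Λ s ω m lam R) (hin : IsIngoingAtEventHorizon M a Λ s ω m R)
    (hout : IsOutgoingAtCosmoHorizon M a Λ ω m R) :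
    ∀ r ∈ Ioo (rPlus M a Λ) (rCosmo M a Λ), R r = 0 :=
  radial_vanishing_of_routeW_nonres_lt_one transfer_holds eulerRLNonRes_holds gaugeGlue_holds
    swappedEnergyVanishing_holds hsub ha hs hω hlam hSR hp₃ hR hin hout

/-- **H3 in full rests on `SpinFlip` alone**: with `Transfer`, `EulerRLNonRes`, `GaugeGlue` and
`SwappedEnergyVanishing` discharged, the cited fact
`CasalsTeixeiraDaCosta2022_partialModeStabilityProp38` follows from the spin-flip statement for
`s ≥ 1`. PROVED. -/
theorem prop38_of_spinFlip (kC : SpinFlip) : CasalsTeixeiraDaCosta2022_partialModeStabilityProp38 :=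
  prop38_of_routeW_nonres transfer_holds eulerRLNonRes_holds gaugeGlue_holds
    swappedEnergyVanishing_holds kC

end RouteW

end Summit.Ventures.KdS
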